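import Summits.FinalStateConjecture.FinalStateConjecture.Theses.StarvedNecks
import HarnessLib

/-!
# Skeleton of item stmt-FinalStateConjecture-13550 `Theses.StarvedNecks.HonestFixedRadiusSettling` after the
# 2026-08-16T23:23Z re-line of route StarvedNecks (lead c8) — ONE stub, which IS item stmt-FinalStateConjecture-17575 by name

The rev-1 generic import G = `HonestFixedRadiusSettling` (plain Christodoulou genericity) is superseded by the rev-2/3
crux G′ = `HonestFixedRadiusSettlingT` (item 17575: tame genericity, rays clause, distinct velocities) and kept in the
route file as a support edge.  Composition = the reduction G′ → G, LANDED as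
`Theorems.StarvedNecks.Retype.honestFixedRadiusSettling_of_T` (p131688, `Theorems/StarvedNecksHonestFixedRadiusSettlingOfT.lean`);
it is re-declared below verbatim (namespace `RetypeCheck`) only because the landed module's olean was not yet built on the
farm when this skeleton was registered.  Nothing else about 13550 is open: 17575 is worked by ITS OWN crux chain (it is the
open-problem generic import of the route), never by a stub worker of 13550; when it lands, 13550 closes with the last line.
-/

-- the doubled `FinalStateConjecture` path component is the summit/problem naming scheme, not a mistake
set_option linter.dupNamespace false

noncomputable section

namespace Summit.FinalStateConjecture.FinalStateConjecture.Theorems.StarvedNecks.RetypeCheck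

open scoped Manifold ContDiff ENNReal Topology
open Filter Set Literature.Geometry.Lorentzian

/-- Tame Christodoulou genericity of `P` (codimension `1`) implies plain Christodoulou genericity of every
pointwise-weaker property `Q` on the admissible class: forget tameness
(`IsTameChristodoulouGeneric.isChristodoulouGeneric`), then use that genericity is antitone in the exceptional
set (the same witness curve through a `Q`-exceptional datum, which is `P`-exceptional). Christodoulou, CQG 16
(1999) A23, p. A24. [folklore] -/
private theorem isChristodoulouGeneric_of_tame_of_imp {X : Type} [TopologicalSpace X] [ChartedSpace E3 X]
    [IsManifold (𝓡 3) ∞ X] {𝓓 : Set (InitialDataSet (𝓡 3) X)} {P Q : InitialDataSet (𝓡 3) X → Prop}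
    (hPQ : ∀ D ∈ 𝓓, P D → Q D) (hP : InitialDataSet.IsTameChristodoulouGeneric 𝓓 P 1) :
    InitialDataSet.IsChristodoulouGeneric 𝓓 Q 1 := by
  intro d hd
  obtain ⟨F, hF, h0, hinj, hmem, hE⟩ :=
    hP.isChristodoulouGeneric d ⟨hd.1, fun h ↦ hd.2 (hPQ d hd.1 h)⟩
  exact ⟨F, hF, h0, hinj, hmem, fun c hc hc' ↦ hE c hc ⟨hc'.1, fun h ↦ hc'.2 (hPQ _ hc'.1 h)⟩⟩

/-- **G′ → G: the rev-1 generic import of route StarvedNecks follows from its re-typed successor.**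
Hypothesis = the body of `Theses.StarvedNecks.HonestFixedRadiusSettlingT` (item stmt-FinalStateConjecture-17575)
verbatim: for every admissible `3`-manifold `X`, TAME-Christodoulou-generically in `admissibleVacuumData X`, the
datum has an MGHD and every MGHD `𝒟` has complete `𝓘⁺` and admits `(O, d, R₀)` — a `C⁴`
`FinalStateDecomposition` `d` of `O = exteriorOf 𝒟 d.charted` — with `RaysStayInClosure 𝒟 O`,
`HonestCore(d, R₀)`, `HonestFar(d, R₀)` and pairwise distinct asymptotic four-velocities `Λᵢ e₀ ≠ Λⱼ e₀`.
Conclusion = the body of `Theses.StarvedNecks.HonestFixedRadiusSettling` (item stmt-FinalStateConjecture-13550)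
verbatim: the same with PLAIN Christodoulou genericity and without the rays and velocity clauses.
Proof: introduce the conclusion's let-bound `Hc`, `Hf` (byte-identical to the hypothesis's), specialise the
hypothesis at `X`, and apply `isChristodoulouGeneric_of_tame_of_imp` to the pointwise implication that forgets
the two extra conjuncts. Christodoulou, CQG 16 (1999) A23, p. A24; Dafermos–Luk arXiv:1710.01722, Conjecture 1.
[folklore] -/
theorem honestFixedRadiusSettling_of_T :
    open Literature.Geometry.Lorentzian in open scoped ContDiff ENNReal in let Hc := ( fun (𝓢 : Spacetime.{0} 4) (O : Set 𝓢.carrier) (k : ℕ) (d : FinalStateDecomposition 𝓢 O k) (R₀ : ℝ) => let B := d.background; let t := fun i ↦ (B i).time; let r := fun i ↦ (B i).radius; let Ψ := d.chart; (∀ i, Kerr.IsSubextremal (d.mass i) (d.spin i) ∧ 100 * d.mass i ≤ R₀ ∧ 0 < ((d.motion i).1 : E4 ≃L[ℝ] E4) (E4.basisVector 0) 0) ∧ (∀ i (ϱ τ₂ : ℝ), R₀ ≤ ϱ → d.τ₀ < τ₂ → Ψ i '' {x | d.τ₀ < t i x.1 ∧ t i x.1 < τ₂ ∧ r i x.1 <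 ϱ} ⊆ 𝓢.metric.causalPast 𝓢.timeOrientation (Ψ i '' (B i).truncTimeSlab ϱ τ₂)) ∧ (∀ i (τ' : ℝ) (ϱ : ℝ → ℝ), Continuous ϱ → d.τ₀ < τ' → let A := Ψ i '' {x | τ' ≤ t i x.1 ∧ r i x.1 ≤ ϱ (t i x.1)}; closure A ∩ O ⊆ A) ∧ (∀ y : d.flatDomain, d.τ₀ < y.1 0 → 𝓢.timeOrientation.IsFutureDirected (mfderiv 𝓘(ℝ, E4) (𝓡 4) d.flatChart y (E4.basisVector 0))) ); let Hf := ( fun (𝓢 : Spacetime.{0} 4) (O : Set 𝓢.carrier) (k : ℕ) (d : FinalStateDecomposition 𝓢 O k) (R₀ : ℝ) => let B := d.background; let t := fun i ↦ (B i).time; let r := fun i ↦ (B i).radius; let Φ := d.flatChart; (∀ τ₂ : ℝ, d.τ₀ < τ₂ → Φ '' {y | d.τ₀ < y.1 0 ∧ y.1 0 < τ₂} ⊆ 𝓢.metric.causalPast 𝓢.timeOrientation (Φ '' (Minkowski.backgroundOn d.flatDomain).timeSlab τ₂)) ∧ (∀ τ' : ℝ, d.τ₀ < τ' → closure (Φ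 '' {y | τ' ≤ y.1 0 ∧ ∀ i, d.excision i (y.1 0) + 1 ≤ r i y.1}) ⊆ Φ '' {y | τ' ≤ y.1 0}) ∧ (∀ i, ∃ T : ℝ, supCkENorm (Subtype.val '' {x : (B i).domain | T ≤ t i x.1 ∧ R₀ ≤ r i x.1 ∧ ∀ j, j ≠ i → r i x.1 ≤ r j x.1}) 0 (𝓢.deviationExtend (B i) (d.chart i)) ≤ ENNReal.ofReal (1 / (10 * ‖(((d.motion i).1 : E4 ≃L[ℝ] E4) : E4 →L[ℝ] E4)‖ ^ 2))) ); (∀ (X : Type) [TopologicalSpace X] [ChartedSpace E3 X] [IsManifold (𝓡 3) ∞ X] [T2Space X] [SecondCountableTopology X] [ConnectedSpace X], InitialDataSet.IsTameChristodoulouGeneric (admissibleVacuumData X) (fun D ↦ (∃ 𝒟 : VacuumCauchyDevelopment D, 𝒟.IsMaximal) ∧ ∀ 𝒟 : VacuumCauchyDevelopment D, 𝒟.IsMaximal → HasCompleteNullInfinity 𝒟.toCauchyDevelopment ∧ ∃ (O : Set 𝒟.carrier) (d : FinalStateDecomposition 𝒟.toSpacetime O 4) (R₀ : ℝ), O = exteriorOf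 𝒟.toCauchyDevelopment d.charted ∧ RaysStayInClosure 𝒟.toCauchyDevelopment O ∧ Hc 𝒟.toSpacetime O 4 d R₀ ∧ Hf 𝒟.toSpacetime O 4 d R₀ ∧ (∀ i j : Fin d.N, i ≠ j → ((d.motion i).1 : E4 ≃L[ℝ] E4) (E4.basisVector 0) ≠ ((d.motion j).1 : E4 ≃L[ℝ] E4) (E4.basisVector 0))) 1) → ∀ (X : Type) [TopologicalSpace X] [ChartedSpace E3 X] [IsManifold (𝓡 3) ∞ X] [T2Space X] [SecondCountableTopology X] [ConnectedSpace X], InitialDataSet.IsChristodoulouGeneric (admissibleVacuumData X) (fun D ↦ (∃ 𝒟 : VacuumCauchyDevelopment D, 𝒟.IsMaximal) ∧ ∀ 𝒟 : VacuumCauchyDevelopment D, 𝒟.IsMaximal → HasCompleteNullInfinity 𝒟.toCauchyDevelopment ∧ ∃ (O : Set 𝒟.carrier) (d : FinalStateDecomposition 𝒟.toSpacetime O 4) (R₀ : ℝ), O = exteriorOf 𝒟.toCauchyDevelopment d.charted ∧ Hc 𝒟.toSpacetime O 4 d R₀ ∧ Hf 𝒟.toSpacetime O 4 d R₀) 1 :=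 by
  intro Hc Hf hT X _ _ _ _ _ _
  refine isChristodoulouGeneric_of_tame_of_imp ?_ (hT X)
  rintro D - ⟨hex, hall⟩
  refine ⟨hex, fun 𝒟 h𝒟 ↦ ?_⟩
  obtain ⟨hscri, O, d, R₀, hO, -, hcore, hfar, -⟩ := hall 𝒟 h𝒟
  exact ⟨hscri, O, d, R₀, hO, hcore, hfar⟩

/-- **stub (= item stmt-FinalStateConjecture-17575 BY NAME; the re-typed generic import, open problem, worked by its own crux chain).** -/
theorem stub_T : Theses.StarvedNecks.HonestFixedRadiusSettlingT := by
  sorry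

/-- **THE SKELETON THEOREM** — item 13550 by name from its one stub via the (landed) reduction G′ → G. -/
theorem HonestFixedRadiusSettling_of : Theses.StarvedNecks.HonestFixedRadiusSettling :=
  honestFixedRadiusSettling_of_T stub_T

end Summit.FinalStateConjecture.FinalStateConjecture.Theorems.StarvedNecks.RetypeCheck

end
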